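import Literature.Analysis.Calculus.IteratedFDerivParamWords   -- ★ p850969 (F0P3a-p08 (g23)): §1 directional-derivative calculus on open sets, the `univ ×ˢ T` reader normal form
import HarnessLib

/-!
# Adapted words are nested partials — the LOCAL form: readers smooth on `Q ×ˢ T` for an open parameter set `Q` (Hörmander, ALPDO I §1.1; Bouaziz 1994 §3.2 (I₃))

Topic `Analysis/Calculus`; namespace `Literature.Analysis.Calculus`.  THEOREMS ONLY (no `def`, no instance, no notation, no axiom, no named fact, no `sorry`), Mathlib + ★
`IteratedFDerivParamWords`.  Cell `pub/hodgecm-mathlib`, crux H413 (`stmt-HodgeConjecture-24833`), F0∕P3c line LH3 (letter L1 clause (I₃) `ArchHcJump`), SPEC-I3 brick (B-trans),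
F0P3a-p08 (g23).  ★ `IteratedFDerivParamWords` §2–§3 assume the readers `z ↦ Φ (g z.1) z.2` smooth on `univ ×ˢ T` (ALL parameters); the COFACTOR reader of (B-trans)
(`(q,t) ↦ K·(c(t)·Π(q) − E(q))`, with `Π, E` the frozen root products — smooth only where the split-place factors do not vanish) and any family cut off near one parameter
need the same statements on `Q ×ˢ T`, `Q ⊆ P` OPEN.  This file is that generalisation, proof for proof (§1 of ★ is already stated on arbitrary open sets and is reused):
* `iteratedDeriv_slice_eq_iterate_fderiv_apply_local` (`q ∈ Q`), `fderiv_iteratedDeriv_reader_transversal_local`, `fderiv_iteratedDeriv_reader_normal_local`,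
  `contDiffOn_iteratedDeriv_reader_local` (hypotheses (H1) `ContDiffOn ℝ ∞ (fun z => Φ (g z.1) z.2) (Q ×ˢ T)`, (H2) on `Q ×ˢ T`);
* **`iteratedFDeriv_readers_eq_iteratedDeriv_foldr_local`** — the normal form for a family of readers `Φ i` on `Q ×ˢ T i` with ONE explicit `g′` (the `foldr` of the
  transversal letters), and `iteratedFDeriv_readers_const_normal_eq_iteratedDeriv_local` (pure-normal words).
HONEST LABEL: pure calculus, count-neutral; HC_CM is proved only modulo the 7 printed citations (2 remaining: hLiu418 = stmt-HodgeConjecture-24832, h413 = stmt-HodgeConjecture-24833)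
until rung 0 closes.

## References
* [HormanderALPDO1] L. Hörmander, *The Analysis of Linear Partial Differential Operators I* (1983∕2003), §1.1 Thm. 1.1.8, (1.1.9) p. 12.
* [Bouaziz1994IntegralesOrbitales] A. Bouaziz, *Intégrales orbitales sur les groupes de Lie réductifs*, Ann. Sci. ÉNS 27 (1994), §3.2 (I₃) p. 580.
* [Shelstad1979] D. Shelstad, *Characters and inner forms of a quasi-split group over ℝ*, Compositio Math. 39 (1979), Lemma 4.3 p. 25.
-/

set_option autoImplicit false

open Set Filter Function
open scoped Topology ContDiff

namespace Literature.Analysis.Calculus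

/-! ## §1 The slice formula on `Q ×ˢ T` -/

section Slice

variable {P : Type*} [NormedAddCommGroup P] [NormedSpace ℝ P] {F : Type*} [NormedAddCommGroup F] [NormedSpace ℝ F]

/-- **THE SLICE FORMULA, LOCAL**: on the open set `Q ×ˢ T`, for `q ∈ Q`, `iteratedDeriv a (fun t => ψ (q, t)) t = (∂_{(0,1)})^[a] ψ (q, t)`. [cite: HormanderALPDO1, §1.1 (1.1.9)] -/
theorem iteratedDeriv_slice_eq_iterate_fderiv_apply_local {Q : Set P} (hQ : IsOpen Q) {T : Set ℝ} (hT : IsOpen T) {ψ : P × ℝ → F}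
    (hψ : ContDiffOn ℝ ∞ ψ (Q ×ˢ T)) (a : ℕ) {q : P} (hq : q ∈ Q) {t : ℝ} (ht : t ∈ T) :
    iteratedDeriv a (fun s : ℝ => ψ (q, s)) t = ((fun φ : P × ℝ → F => fun y => fderiv ℝ φ y ((0 : P), (1 : ℝ)))^[a] ψ) (q, t) := by
  have hO : IsOpen (Q ×ˢ T : Set (P × ℝ)) := hQ.prod hT
  induction a generalizing t with
  | zero => simp
  | succ a ih =>
    rw [iteratedDeriv_succ, Function.iterate_succ', Function.comp_apply]
    have hev : (iteratedDeriv a fun s : ℝ => ψ (q, s)) =ᶠ[𝓝 t]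
        fun s => ((fun φ : P × ℝ → F => fun y => fderiv ℝ φ y ((0 : P), (1 : ℝ)))^[a] ψ) (q, s) :=
      Filter.eventuallyEq_of_mem (hT.mem_nhds ht) fun s hs => ih hs
    rw [hev.deriv_eq]
    have hsm := contDiffOn_iterate_fderiv_apply_of_isOpen hO hψ ((0 : P), (1 : ℝ)) a
    have hd : DifferentiableAt ℝ ((fun φ : P × ℝ → F => fun y => fderiv ℝ φ y ((0 : P), (1 : ℝ)))^[a] ψ) (q, t) :=
      (hsm.contDiffAt (hO.mem_nhds ⟨hq, ht⟩)).differentiableAt (by simp)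
    exact deriv_slice_eq_fderiv_apply hd

end Slice

/-! ## §2 Readers on `Q ×ˢ T` -/

section Reader

variable {P : Type*} [NormedAddCommGroup P] [NormedSpace ℝ P] {Y : Type*} {V : Type*} {F : Type*} [NormedAddCommGroup F] [NormedSpace ℝ F]

/-- **THE TRANSVERSAL DERIVATIVE PASSES EVERY NORMAL JET (local)**: (H1) on `Q ×ˢ T`, (H2) on `Q ×ˢ T` ⇒ `∂_{(v,0)} (z ↦ iteratedDeriv a (Φ (g z.1)) z.2) = iteratedDeriv a (Φ (g′ z.1)) z.2`
on `Q ×ˢ T`. [cite: HormanderALPDO1, §1.1 Thm. 1.1.8, (1.1.9)] [cite: Bouaziz1994IntegralesOrbitales, §3.2 (I₃) p. 580] -/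
theorem fderiv_iteratedDeriv_reader_transversal_local {Q : Set P} (hQ : IsOpen Q) {T : Set ℝ} (hT : IsOpen T) (Φ : (Y → V) → ℝ → F) (g g' : P → Y → V)
    (h1 : ContDiffOn ℝ ∞ (fun z : P × ℝ => Φ (g z.1) z.2) (Q ×ˢ T)) (h1' : ContDiffOn ℝ ∞ (fun z : P × ℝ => Φ (g' z.1) z.2) (Q ×ˢ T)) (v : P)
    (h2 : ∀ z : P × ℝ, z ∈ Q ×ˢ T → fderiv ℝ (fun z : P × ℝ => Φ (g z.1) z.2) z (v, 0) = Φ (g' z.1) z.2) (a : ℕ)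
    {z : P × ℝ} (hz : z ∈ Q ×ˢ T) :
    fderiv ℝ (fun y : P × ℝ => iteratedDeriv a (Φ (g y.1)) y.2) z (v, 0) = iteratedDeriv a (Φ (g' z.1)) z.2 := by
  have hO : IsOpen (Q ×ˢ T : Set (P × ℝ)) := hQ.prod hT
  set D : (P × ℝ → F) → (P × ℝ → F) := fun φ y => fderiv ℝ φ y ((0 : P), (1 : ℝ)) with hD
  have hL : EqOn (fun y : P × ℝ => iteratedDeriv a (Φ (g y.1)) y.2) (D^[a] fun y : P × ℝ => Φ (g y.1) y.2) (Q ×ˢ T) := by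
    rintro ⟨q, t⟩ ⟨hq, ht⟩
    exact iteratedDeriv_slice_eq_iterate_fderiv_apply_local hQ hT h1 a hq ht
  have e1 := eqOn_fderiv_apply_of_eqOn hO hL (v, 0) hz
  simp only [] at e1
  rw [e1]
  have e2 := fderiv_iterate_fderiv_apply_comm_of_isOpen hO h1 (v, 0) ((0 : P), (1 : ℝ)) a hz
  simp only [] at e2
  rw [hD, e2]
  have hin : EqOn (fun y : P × ℝ => fderiv ℝ (fun z : P × ℝ => Φ (g z.1) z.2) y (v, 0)) (fun y : P × ℝ => Φ (g' y.1) y.2) (Q ×ˢ T) :=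
    fun y hy => h2 y hy
  rw [eqOn_iterate_fderiv_apply_of_eqOn hO hin ((0 : P), (1 : ℝ)) a hz]
  obtain ⟨q, t⟩ := z
  exact (iteratedDeriv_slice_eq_iterate_fderiv_apply_local hQ hT h1' a hz.1 hz.2).symm

/-- **THE NORMAL DERIVATIVE RAISES THE JET ORDER (local)** on `Q ×ˢ T`. [cite: HormanderALPDO1, §1.1 (1.1.9)] -/
theorem fderiv_iteratedDeriv_reader_normal_local {Q : Set P} (hQ : IsOpen Q) {T : Set ℝ} (hT : IsOpen T) (Φ : (Y → V) → ℝ → F) (g : P → Y → V)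
    (h1 : ContDiffOn ℝ ∞ (fun z : P × ℝ => Φ (g z.1) z.2) (Q ×ˢ T)) (a : ℕ) {z : P × ℝ} (hz : z ∈ Q ×ˢ T) :
    fderiv ℝ (fun y : P × ℝ => iteratedDeriv a (Φ (g y.1)) y.2) z ((0 : P), (1 : ℝ)) = iteratedDeriv (a + 1) (Φ (g z.1)) z.2 := by
  have hO : IsOpen (Q ×ˢ T : Set (P × ℝ)) := hQ.prod hT
  have hL : EqOn (fun y : P × ℝ => iteratedDeriv a (Φ (g y.1)) y.2)
      ((fun φ : P × ℝ → F => fun y => fderiv ℝ φ y ((0 : P), (1 : ℝ)))^[a] fun y : P × ℝ => Φ (g y.1) y.2) (Q ×ˢ T) := by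
    rintro ⟨q, t⟩ ⟨hq, ht⟩
    exact iteratedDeriv_slice_eq_iterate_fderiv_apply_local hQ hT h1 a hq ht
  have e1 := eqOn_fderiv_apply_of_eqOn hO hL ((0 : P), (1 : ℝ)) hz
  simp only [] at e1
  rw [e1]
  obtain ⟨q, t⟩ := z
  rw [iteratedDeriv_slice_eq_iterate_fderiv_apply_local hQ hT h1 (a + 1) hz.1 hz.2, Function.iterate_succ', Function.comp_apply]

/-- The normal jets are `C^∞` on `Q ×ˢ T` (local). [cite: HormanderALPDO1, §1.1 Thm. 1.1.8] -/
theorem contDiffOn_iteratedDeriv_reader_local {Q : Set P} (hQ : IsOpen Q) {T : Set ℝ} (hT : IsOpen T) (Φ : (Y → V) → ℝ → F) (g : P → Y → V)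
    (h1 : ContDiffOn ℝ ∞ (fun z : P × ℝ => Φ (g z.1) z.2) (Q ×ˢ T)) (a : ℕ) :
    ContDiffOn ℝ ∞ (fun y : P × ℝ => iteratedDeriv a (Φ (g y.1)) y.2) (Q ×ˢ T) := by
  have hO : IsOpen (Q ×ˢ T : Set (P × ℝ)) := hQ.prod hT
  have hL : EqOn (fun y : P × ℝ => iteratedDeriv a (Φ (g y.1)) y.2)
      ((fun φ : P × ℝ → F => fun y => fderiv ℝ φ y ((0 : P), (1 : ℝ)))^[a] fun y : P × ℝ => Φ (g y.1) y.2) (Q ×ˢ T) := by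
    rintro ⟨q, t⟩ ⟨hq, ht⟩
    exact iteratedDeriv_slice_eq_iterate_fderiv_apply_local hQ hT h1 a hq ht
  exact (contDiffOn_iterate_fderiv_apply_of_isOpen hO h1 _ a).congr hL

end Reader

/-! ## §3 The local normal form for a family of readers -/

section NormalForm

variable {P : Type*} [NormedAddCommGroup P] [NormedSpace ℝ P] {Y : Type*} {V : Type*} {F : Type*} [NormedAddCommGroup F] [NormedSpace ℝ F]
  {ι : Type*}

/-- **ADAPTED WORDS ARE NESTED PARTIALS — LOCAL NORMAL FORM for a family of readers** on `Q ×ˢ T i`, `Q` open: with the SAME explicit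
`g′ := (List.ofFn fun r => (σ r, (w r).1)).foldr (fun l g => if l.1 then g else D l.2 g) g`, for every reader `i` and every `z ∈ Q ×ˢ T i`,
`iteratedFDeriv ℝ k (fun z => Φ i (g z.1) z.2) z w = iteratedDeriv ((List.ofFn σ).count true) (Φ i (g′ z.1)) z.2`. [cite: HormanderALPDO1, §1.1 Thm. 1.1.8, (1.1.9)]
[cite: Bouaziz1994IntegralesOrbitales, §3.2 (I₃) p. 580] [cite: Shelstad1979, Lemma 4.3 (p. 25)] -/
theorem iteratedFDeriv_readers_eq_iteratedDeriv_foldr_local {Q : Set P} (hQ : IsOpen Q) (T : ι → Set ℝ) (hT : ∀ i, IsOpen (T i)) (Φ : ι → (Y → V) → ℝ → F)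
    (Adm : (P → Y → V) → Prop) (D : P → (P → Y → V) → (P → Y → V))
    (hcl : ∀ g, Adm g → ∀ v, Adm (D v g))
    (h1 : ∀ i g, Adm g → ContDiffOn ℝ ∞ (fun z : P × ℝ => Φ i (g z.1) z.2) (Q ×ˢ T i))
    (h2 : ∀ i g, Adm g → ∀ (v : P) (z : P × ℝ), z ∈ Q ×ˢ T i → fderiv ℝ (fun z : P × ℝ => Φ i (g z.1) z.2) z (v, 0) = Φ i (D v g z.1) z.2)
    {k : ℕ} (w : Fin k → P × ℝ) (σ : Fin k → Bool) (hwn : ∀ r, σ r = true → w r = ((0 : P), (1 : ℝ))) (hwt : ∀ r, σ r = false → (w r).2 = 0)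
    (g : P → Y → V) (hg : Adm g) :
    Adm ((List.ofFn fun r => (σ r, (w r).1)).foldr (fun l g => if l.1 then g else D l.2 g) g) ∧
    ∀ (i : ι) (z : P × ℝ), z ∈ Q ×ˢ T i →
      iteratedFDeriv ℝ k (fun z : P × ℝ => Φ i (g z.1) z.2) z w =
        iteratedDeriv ((List.ofFn σ).count true) (Φ i (((List.ofFn fun r => (σ r, (w r).1)).foldr (fun l g => if l.1 then g else D l.2 g) g) z.1)) z.2 := by
  induction k with
  | zero =>
    refine ⟨by simpa using hg, fun i z _ => ?_⟩
    simp
  | succ k ih =>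
    have htn : ∀ r : Fin k, (σ ∘ Fin.succ) r = true → Fin.tail w r = ((0 : P), (1 : ℝ)) := fun r hr => hwn r.succ hr
    have htt : ∀ r : Fin k, (σ ∘ Fin.succ) r = false → (Fin.tail w r).2 = 0 := fun r hr => hwt r.succ hr
    obtain ⟨hAdmt, hIH⟩ := ih (Fin.tail w) (σ ∘ Fin.succ) htn htt
    set gt : P → Y → V := (List.ofFn fun r : Fin k => ((σ ∘ Fin.succ) r, (Fin.tail w r).1)).foldr (fun l g => if l.1 then g else D l.2 g) g with hgt
    have hfold : (List.ofFn fun r : Fin (k + 1) => (σ r, (w r).1)).foldr (fun l g => if l.1 then g else D l.2 g) g =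
        (if σ 0 then gt else D (w 0).1 gt) := by
      rw [List.ofFn_succ, List.foldr_cons]
      rfl
    have hcount : (List.ofFn σ).count true = (if σ 0 then 1 else 0) + (List.ofFn (σ ∘ Fin.succ)).count true := by
      rw [List.ofFn_succ, List.count_cons]
      cases h0 : σ 0 <;> simp [Nat.add_comm, Function.comp_def]
    rw [hfold, hcount]
    refine ⟨by cases h0 : σ 0 <;> simp [hAdmt, hcl _ hAdmt], fun i z hz => ?_⟩
    have hO : IsOpen (Q ×ˢ T i : Set (P × ℝ)) := hQ.prod (hT i)
    have hdiff : DifferentiableAt ℝ (iteratedFDeriv ℝ k (fun z : P × ℝ => Φ i (g z.1) z.2)) z :=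
      ((h1 i g hg).contDiffAt (hO.mem_nhds hz)).differentiableAt_iteratedFDeriv (WithTop.coe_lt_coe.2 (ENat.coe_lt_top k))
    rw [hdiff.iteratedFDeriv_succ_apply_left']
    have hL : EqOn (fun y : P × ℝ => iteratedFDeriv ℝ k (fun z : P × ℝ => Φ i (g z.1) z.2) y (Fin.tail w))
        (fun y : P × ℝ => iteratedDeriv ((List.ofFn (σ ∘ Fin.succ)).count true) (Φ i (gt y.1)) y.2) (Q ×ˢ T i) :=
      fun y hy => hIH i y hy
    have e1 := eqOn_fderiv_apply_of_eqOn hO hL (w 0) hz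
    simp only [] at e1
    rw [e1]
    cases h0 : σ 0 with
    | true =>
      rw [hwn 0 h0]
      simp only [if_true, Nat.add_comm 1]
      exact fderiv_iteratedDeriv_reader_normal_local hQ (hT i) (Φ i) gt (h1 i gt hAdmt) _ hz
    | false =>
      have hw0 : w 0 = ((w 0).1, (0 : ℝ)) := Prod.ext rfl (hwt 0 h0)
      rw [hw0]
      simp only [Bool.false_eq_true, if_false, Nat.zero_add]
      exact fderiv_iteratedDeriv_reader_transversal_local hQ (hT i) (Φ i) gt (D (w 0).1 gt) (h1 i gt hAdmt) (h1 i _ (hcl _ hAdmt _)) (w 0).1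
        (fun y hy => h2 i gt hAdmt (w 0).1 y hy) _ hz

/-- **Pure-normal words (local)**: the family is untouched. [cite: HormanderALPDO1, §1.1 (1.1.9)] -/
theorem iteratedFDeriv_readers_const_normal_eq_iteratedDeriv_local {Q : Set P} (hQ : IsOpen Q) (T : ι → Set ℝ) (hT : ∀ i, IsOpen (T i)) (Φ : ι → (Y → V) → ℝ → F)
    (Adm : (P → Y → V) → Prop) (D : P → (P → Y → V) → (P → Y → V))
    (hcl : ∀ g, Adm g → ∀ v, Adm (D v g))
    (h1 : ∀ i g, Adm g → ContDiffOn ℝ ∞ (fun z : P × ℝ => Φ i (g z.1) z.2) (Q ×ˢ T i))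
    (h2 : ∀ i g, Adm g → ∀ (v : P) (z : P × ℝ), z ∈ Q ×ˢ T i → fderiv ℝ (fun z : P × ℝ => Φ i (g z.1) z.2) z (v, 0) = Φ i (D v g z.1) z.2)
    (k : ℕ) (g : P → Y → V) (hg : Adm g) (i : ι) (z : P × ℝ) (hz : z ∈ Q ×ˢ T i) :
    iteratedFDeriv ℝ k (fun z : P × ℝ => Φ i (g z.1) z.2) z (fun _ => ((0 : P), (1 : ℝ))) = iteratedDeriv k (Φ i (g z.1)) z.2 := by
  have h := (iteratedFDeriv_readers_eq_iteratedDeriv_foldr_local hQ T hT Φ Adm D hcl h1 h2 (fun _ : Fin k => ((0 : P), (1 : ℝ))) (fun _ => true)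
    (fun _ _ => rfl) (fun _ h => by simp at h) g hg).2 i z hz
  rw [h]
  congr 1
  · simp
  · congr 1
    suffices hf : ∀ (l : List (Bool × P)), (∀ x ∈ l, x.1 = true) → l.foldr (fun l g => if l.1 then g else D l.2 g) g = g by
      rw [hf _ (by simp)]
    intro l hl
    induction l with
    | nil => rfl
    | cons a l ihl =>
      rw [List.foldr_cons, ihl (fun x hx => hl x (List.mem_cons_of_mem _ hx)), if_pos (hl a (by simp))]

end NormalForm

end Literature.Analysis.Calculus
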